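import Mathlib.Analysis.SpecialFunctions.Pow.Real
import Mathlib.Analysis.SpecialFunctions.Pow.Continuity
import Mathlib.Analysis.SpecificLimits.Basic
import Mathlib.Topology.Algebra.Order.Field
import Mathlib.Tactic.Linarith
import Mathlib.Tactic.FieldSimp
import Mathlib.Tactic.Positivity
import HarnessLib

/-!
# Speed of convergence: order, linear and superlinear convergence, average rates (Luenberger–Ye, §6.7)

[LY08] = D. G. Luenberger, Y. Ye, *Linear and Nonlinear Programming* [LuenbergerYe2008], chapter
"Basic Properties of Solutions and Algorithms" (Ch. 6 in the held copy
`book:luenberger2008-linear-nonlinear-programming`; Ch. 7 of the Springer 2008 printing), §6.7 "Speed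
of convergence": the Definitions of the order of convergence, of linear convergence with convergence
ratio `β`, of superlinear convergence, of the average convergence ratio, Examples 1–6, and the
Proposition on the insensitivity of the average ratio to the error function.

What is recorded (sequences `r : ℕ → ℝ` with limit `r*`; `e_k = |r_k − r*|`):
* `stepRatio r r* k = e_{k+1}/e_k` and `stepRatioPow r r* p k = e_{k+1}/e_k^p` — the quantities whose
  (upper) limits define the convergence ratio and the order; `OrderAtLeast r r* p` — the tail bound
  `e_{k+1} ≤ C·e_k^p` expressing "`lim sup e_{k+1}/e_k^p < ∞`", i.e. order at least `p`;
  `ConvergesLinearly r r* β` (`e_{k+1}/e_k → β < 1`), `ConvergesSuperlinearly` (`β = 0`),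
  `avgRoot r r* k = e_k^{1/k}` and `HasAverageRatio` (the average convergence ratio, in the case where
  the defining `lim sup` is a limit);
* Example 1 (`r_k = aᵏ`, `0 < a < 1`: ratio identically `a`, linear with ratio `a`, order ≥ 1);
  Example 2 (`r_k = a^(2ᵏ)`: `r_{k+1} = r_k²`, so `e_{k+1}/e_k² = 1` and the order is ≥ 2);
  Example 3 (`r_k = 1/k`: ratio `k/(k+1) → 1`, hence NOT linearly convergent);
  Example 4 (`r_k = (1/k)ᵏ`: ratio `≤ 1/(k+1) → 0`, superlinear);
  Example 6 / the geometric sequence (`(c·aᵏ)^{1/k} → a`: average ratio `a`; the elementary limit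
  `c^{1/k} → 1` used inside is the tree's `HexBW.tendsto_const_rpow_one_div_nat₀`, inlined);
* the **Proposition** of §6.7: if two error functions satisfy `0 ≤ a₁ g ≤ f ≤ a₂ g` with
  `a₁, a₂ > 0`, then linear convergence with average ratio `β` with respect to `f` implies the same
  with respect to `g` (`averageRatio_of_sandwich`; the book's two `lim sup` inequalities become a
  squeeze between `(f_k/a₂)^{1/k}` and `(f_k/a₁)^{1/k}`).

Published results only (Lean placement rule): every public declaration carries its
`[cite: LuenbergerYe2008, §6.7 …]` locator.
-/

namespace Literature.Analysis.Convex.SpeedOfConvergence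

open Filter Topology

/-! ### Step-wise notions -/

/-- The step ratio `|r_{k+1} − r*| / |r_k − r*|` whose limit is the convergence ratio `β`.
[cite: LuenbergerYe2008, §6.7 Definition (linear convergence, convergence ratio)] -/
noncomputable def stepRatio (r : ℕ → ℝ) (rstar : ℝ) (k : ℕ) : ℝ :=
  |r (k + 1) - rstar| / |r k - rstar|

/-- The ratio `|r_{k+1} − r*| / |r_k − r*|^p` whose upper limit decides whether the order of
convergence is at least `p`. [cite: LuenbergerYe2008, §6.7 Definition (order of convergence)] -/
noncomputable def stepRatioPow (r : ℕ → ℝ) (rstar p : ℝ) (k : ℕ) : ℝ :=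
  |r (k + 1) - rstar| / |r k - rstar| ^ p

/-- "Order at least `p`": the tail bound `|r_{k+1} − r*| ≤ C |r_k − r*|^p` for some constant `C`
and all large `k` — the finiteness `lim sup |r_{k+1} − r*|/|r_k − r*|^p < ∞` of the Definition, in a
form that needs no convention for `0/0`; the order of convergence is the supremum of such `p`.
[cite: LuenbergerYe2008, §6.7 Definition (order of convergence)] -/
def OrderAtLeast (r : ℕ → ℝ) (rstar p : ℝ) : Prop :=
  ∃ C : ℝ, ∀ᶠ k in atTop, |r (k + 1) - rstar| ≤ C * |r k - rstar| ^ p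

/-- **Definition (linear convergence).** `r_k → r*` *linearly with convergence ratio `β`* if
`|r_{k+1} − r*|/|r_k − r*| → β < 1`. [cite: LuenbergerYe2008, §6.7 Definition (linear
convergence)] -/
def ConvergesLinearly (r : ℕ → ℝ) (rstar β : ℝ) : Prop :=
  Tendsto r atTop (𝓝 rstar) ∧ Tendsto (stepRatio r rstar) atTop (𝓝 β) ∧ β < 1

/-- **Superlinear convergence**: the case `β = 0` of linear convergence.
[cite: LuenbergerYe2008, §6.7 (superlinear convergence, "The ultimate case where β = 0")] -/
def ConvergesSuperlinearly (r : ℕ → ℝ) (rstar : ℝ) : Prop :=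
  Tendsto r atTop (𝓝 rstar) ∧ Tendsto (stepRatio r rstar) atTop (𝓝 0)

/-- Superlinear convergence is linear convergence with ratio `0`.
[cite: LuenbergerYe2008, §6.7 (superlinear convergence)] -/
theorem convergesSuperlinearly_iff (r : ℕ → ℝ) (rstar : ℝ) :
    ConvergesSuperlinearly r rstar ↔ ConvergesLinearly r rstar 0 := by
  unfold ConvergesSuperlinearly ConvergesLinearly
  constructor
  · rintro ⟨h1, h2⟩; exact ⟨h1, h2, zero_lt_one⟩
  · rintro ⟨h1, h2, -⟩; exact ⟨h1, h2⟩

/-- A sequence that eventually satisfies `|r_{k+1} − r*| ≤ β|r_k − r*|` has order at least one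
(with `C = β`). [cite: LuenbergerYe2008, §6.7 (linear convergence: "a tail that converges at least
as fast as the geometric sequence cβᵏ")] -/
theorem orderAtLeast_one_of_ratio_le {r : ℕ → ℝ} {rstar β : ℝ}
    (h : ∀ᶠ k in atTop, |r (k + 1) - rstar| ≤ β * |r k - rstar|) : OrderAtLeast r rstar 1 :=
  ⟨β, by simpa [Real.rpow_one] using h⟩

/-! ### Examples 1–4 -/

/-- **Example 1.** `r_k = aᵏ`, `0 < a < 1`: the step ratio is identically `a`
(`r_{k+1}/r_k = a`). [cite: LuenbergerYe2008, §6.7 Example 1] -/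
theorem example1_stepRatio {a : ℝ} (ha0 : 0 < a) (k : ℕ) :
    stepRatio (fun k => a ^ k) 0 k = a := by
  unfold stepRatio
  rw [sub_zero, sub_zero, abs_of_pos (pow_pos ha0 _), abs_of_pos (pow_pos ha0 _), pow_succ,
    mul_div_cancel_left₀ _ (pow_pos ha0 k).ne']

/-- **Example 1 (conclusion).** `aᵏ → 0` linearly with convergence ratio `a` (order unity).
[cite: LuenbergerYe2008, §6.7 Example 1] -/
theorem example1_linear {a : ℝ} (ha0 : 0 < a) (ha1 : a < 1) :
    ConvergesLinearly (fun k => a ^ k) 0 a := by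
  refine ⟨tendsto_pow_atTop_nhds_zero_of_lt_one ha0.le ha1, ?_, ha1⟩
  have : stepRatio (fun k => a ^ k) 0 = fun _ => a := funext (example1_stepRatio ha0)
  rw [this]
  exact tendsto_const_nhds

/-- Example 1 has order at least one (`|r_{k+1}| = a|r_k|`). [cite: LuenbergerYe2008, §6.7
Example 1] -/
theorem example1_orderAtLeast_one {a : ℝ} (ha0 : 0 < a) :
    OrderAtLeast (fun k => a ^ k) 0 1 := by
  refine orderAtLeast_one_of_ratio_le (β := a) (Eventually.of_forall fun k => ?_)
  rw [sub_zero, sub_zero, abs_of_pos (pow_pos ha0 _), abs_of_pos (pow_pos ha0 _), pow_succ,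
    mul_comm]

/-- **Example 2.** `r_k = a^(2ᵏ)`: `r_{k+1} = r_k²`. [cite: LuenbergerYe2008, §6.7 Example 2] -/
theorem example2_succ (a : ℝ) (k : ℕ) : a ^ 2 ^ (k + 1) = (a ^ 2 ^ k) ^ 2 := by
  rw [pow_succ, pow_mul]

/-- **Example 2 (conclusion).** For `0 < a` the ratio `|r_{k+1}|/|r_k|²` is identically `1`, so
the order of convergence is (at least) two, with constant `C = 1`.
[cite: LuenbergerYe2008, §6.7 Example 2] -/
theorem example2_stepRatioPow {a : ℝ} (ha0 : 0 < a) (k : ℕ) :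
    stepRatioPow (fun k => a ^ 2 ^ k) 0 2 k = 1 := by
  unfold stepRatioPow
  dsimp only
  have hpos : 0 < a ^ 2 ^ k := pow_pos ha0 _
  rw [sub_zero, sub_zero, example2_succ, abs_of_pos (pow_pos hpos 2), abs_of_pos hpos,
    Real.rpow_two, div_self (pow_pos hpos 2).ne']

/-- Example 2 has order at least two. [cite: LuenbergerYe2008, §6.7 Example 2] -/
theorem example2_orderAtLeast_two {a : ℝ} (ha0 : 0 < a) :
    OrderAtLeast (fun k => a ^ 2 ^ k) 0 2 := by
  refine ⟨1, Eventually.of_forall fun k => ?_⟩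
  dsimp only
  have hpos : 0 < a ^ 2 ^ k := pow_pos ha0 _
  rw [sub_zero, sub_zero, example2_succ, abs_of_pos (pow_pos hpos 2), abs_of_pos hpos,
    Real.rpow_two, one_mul]

/-- Example 2 converges to zero for `0 ≤ a < 1` (indeed superlinearly: the step ratio is
`a^(2ᵏ) → 0`). [cite: LuenbergerYe2008, §6.7 Example 2] -/
theorem example2_superlinear {a : ℝ} (ha0 : 0 < a) (ha1 : a < 1) :
    ConvergesSuperlinearly (fun k => a ^ 2 ^ k) 0 := by
  have hlim : Tendsto (fun k : ℕ => a ^ 2 ^ k) atTop (𝓝 0) := by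
    have h1 := tendsto_pow_atTop_nhds_zero_of_lt_one ha0.le ha1
    have h2 : Tendsto (fun k : ℕ => 2 ^ k) atTop atTop :=
      tendsto_pow_atTop_atTop_of_one_lt one_lt_two
    exact h1.comp h2
  refine ⟨hlim, ?_⟩
  have : stepRatio (fun k => a ^ 2 ^ k) 0 = fun k => a ^ 2 ^ k := by
    funext k
    unfold stepRatio
    dsimp only
    have hpos : 0 < a ^ 2 ^ k := pow_pos ha0 _
    rw [sub_zero, sub_zero, example2_succ, abs_of_pos (pow_pos hpos 2), abs_of_pos hpos, pow_two,
      mul_div_cancel_left₀ _ hpos.ne']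
  rw [this]
  exact hlim

/-- **Example 3.** `r_k = 1/k`: the step ratio is `k/(k+1)` (for `k ≥ 1`).
[cite: LuenbergerYe2008, §6.7 Example 3] -/
theorem example3_stepRatio {k : ℕ} (hk : k ≠ 0) :
    stepRatio (fun k => 1 / (k : ℝ)) 0 k = (k : ℝ) / ((k : ℝ) + 1) := by
  unfold stepRatio
  have hk' : (0 : ℝ) < k := by exact_mod_cast Nat.pos_of_ne_zero hk
  rw [sub_zero, sub_zero, abs_of_pos (by positivity), abs_of_pos (by positivity)]
  push_cast
  field_simp

/-- **Example 3 (conclusion).** The ratio tends to `1`, so `β` is not strictly less than one: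
`1/k → 0` with order one but NOT linearly, for any ratio `β`. [cite: LuenbergerYe2008, §6.7
Example 3] -/
theorem example3_not_linear (β : ℝ) : ¬ ConvergesLinearly (fun k => 1 / (k : ℝ)) 0 β := by
  rintro ⟨-, hβ, hβ1⟩
  have h1 : Tendsto (stepRatio (fun k => 1 / (k : ℝ)) 0) atTop (𝓝 1) := by
    have h := tendsto_natCast_div_add_atTop (1 : ℝ)
    refine h.congr' ?_
    filter_upwards [eventually_ne_atTop 0] with k hk
    rw [example3_stepRatio hk]
  have := tendsto_nhds_unique hβ h1
  linarith

/-- **Example 4.** `r_k = (1/k)ᵏ`: the step ratio is at most `1/(k+1)`.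
[cite: LuenbergerYe2008, §6.7 Example 4] -/
theorem example4_stepRatio_le (k : ℕ) :
    stepRatio (fun k => (1 / (k : ℝ)) ^ k) 0 k ≤ 1 / ((k : ℝ) + 1) := by
  unfold stepRatio
  rw [sub_zero, sub_zero]
  rcases Nat.eq_zero_or_pos k with hk | hk
  · subst hk; norm_num
  · have hk' : (0 : ℝ) < k := by exact_mod_cast hk
    have hpos : (0 : ℝ) < (1 / (k : ℝ)) ^ k := by positivity
    have hpos' : (0 : ℝ) < (1 / ((k : ℝ) + 1)) ^ (k + 1) := by positivity
    rw [abs_of_pos (by push_cast; exact hpos'), abs_of_pos hpos, div_le_iff₀ hpos]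
    push_cast
    rw [pow_succ]
    have hle : (1 / ((k : ℝ) + 1)) ^ k ≤ (1 / (k : ℝ)) ^ k := by
      apply pow_le_pow_left₀ (by positivity)
      exact one_div_le_one_div_of_le hk' (by linarith)
    have hnn : (0 : ℝ) ≤ 1 / ((k : ℝ) + 1) := by positivity
    nlinarith

/-- The step ratio of Example 4 is nonnegative. [cite: LuenbergerYe2008, §6.7 Example 4] -/
theorem example4_stepRatio_nonneg (k : ℕ) : 0 ≤ stepRatio (fun k => (1 / (k : ℝ)) ^ k) 0 k := by
  unfold stepRatio
  positivity

/-- **Example 4 (conclusion).** `(1/k)ᵏ → 0` superlinearly: the step ratio tends to `0`.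
[cite: LuenbergerYe2008, §6.7 Example 4] -/
theorem example4_superlinear : ConvergesSuperlinearly (fun k => (1 / (k : ℝ)) ^ k) 0 := by
  refine ⟨?_, ?_⟩
  · -- |r_k| ≤ 1/k for k ≥ 1
    refine squeeze_zero' (Eventually.of_forall fun k => by positivity) ?_
      tendsto_one_div_atTop_nhds_zero_nat
    filter_upwards [eventually_ge_atTop 1] with k hk
    have hk' : (1 : ℝ) ≤ k := by exact_mod_cast hk
    calc (1 / (k : ℝ)) ^ k ≤ (1 / (k : ℝ)) ^ 1 := by
          apply pow_le_pow_of_le_one (by positivity) ?_ hk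
          rw [div_le_one (by linarith)]; exact hk'
      _ = 1 / (k : ℝ) := pow_one _
  · exact squeeze_zero' (Eventually.of_forall example4_stepRatio_nonneg)
      (Eventually.of_forall example4_stepRatio_le) tendsto_one_div_add_atTop_nhds_zero_nat

/-! ### Average rates -/

/-- The `k`-th root `|r_k − r*|^{1/k}` whose (upper) limit is the average convergence ratio.
[cite: LuenbergerYe2008, §6.7 Definition (average convergence ratio)] -/
noncomputable def avgRoot (r : ℕ → ℝ) (rstar : ℝ) (k : ℕ) : ℝ :=
  |r k - rstar| ^ (1 / (k : ℝ))

/-- *Average convergence ratio `β`* in the case where the defining `lim sup |r_k − r*|^{1/k}` is a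
limit. [cite: LuenbergerYe2008, §6.7 Definition (average convergence ratio)] -/
def HasAverageRatio (r : ℕ → ℝ) (rstar β : ℝ) : Prop :=
  Tendsto (avgRoot r rstar) atTop (𝓝 β)

/-- **Example 6 / geometric sequence.** For `r_k = c·aᵏ` (`c > 0`, `0 < a`), `|r_k|^{1/k} =
c^{1/k}·a → a`: the average convergence ratio is `a`. [cite: LuenbergerYe2008, §6.7 Example 6 and
the sentence after it ("for the geometric sequence r_k = caᵏ … the average convergence ratio is
a")] -/
theorem geometric_hasAverageRatio {c a : ℝ} (hc : 0 < c) (ha : 0 < a) :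
    HasAverageRatio (fun k => c * a ^ k) 0 a := by
  unfold HasAverageRatio
  have key : ∀ k : ℕ, k ≠ 0 → avgRoot (fun k => c * a ^ k) 0 k = c ^ (1 / (k : ℝ)) * a := by
    intro k hk
    unfold avgRoot
    rw [sub_zero, abs_of_pos (by positivity), Real.mul_rpow hc.le (pow_nonneg ha.le _),
      one_div, Real.pow_rpow_inv_natCast ha.le hk]
  -- `c^{1/k} → 1`: the tree's `HexBW.tendsto_const_rpow_one_div_nat₀` (not importable under the
  -- snapshot rule), inlined
  have hroot : Tendsto (fun k : ℕ => c ^ (1 / (k : ℝ))) atTop (𝓝 1) := by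
    have h2 := (Real.continuousAt_const_rpow hc.ne').tendsto.comp tendsto_one_div_atTop_nhds_zero_nat
    simpa [Function.comp_def, Real.rpow_zero] using h2
  have h := hroot.mul_const a
  rw [one_mul] at h
  refine h.congr' ?_
  filter_upwards [eventually_ne_atTop 0] with k hk
  rw [key k hk]

/-- **Example 6.** `r_k = aᵏ`: average convergence ratio `a` (average order unity).
[cite: LuenbergerYe2008, §6.7 Example 6] -/
theorem example6_hasAverageRatio {a : ℝ} (ha : 0 < a) :
    HasAverageRatio (fun k => a ^ k) 0 a := by
  have := geometric_hasAverageRatio one_pos ha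
  simpa using this

/-- **Example 5.** `r_k = a^(2ᵏ)`: `|r_k|^{1/2ᵏ} = a`. [cite: LuenbergerYe2008, §6.7 Example 5] -/
theorem example5_root {a : ℝ} (ha : 0 ≤ a) (k : ℕ) :
    (a ^ 2 ^ k) ^ (1 / ((2 : ℝ) ^ k)) = a := by
  have h : ((2 ^ k : ℕ) : ℝ) = (2 : ℝ) ^ k := by push_cast; ring
  rw [← h, one_div, Real.pow_rpow_inv_natCast ha (pow_ne_zero k two_ne_zero)]

/-! ### The Proposition: the average ratio does not depend on the error function -/

/-- **Proposition (§6.7).** Let `f`, `g` be two error sequences with `0 ≤ a₁ g_k ≤ f_k ≤ a₂ g_k`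
for fixed `a₁, a₂ > 0`.  If `f_k^{1/k} → β` (linear convergence with average ratio `β` with
respect to `f`) then `g_k^{1/k} → β` as well — the book's two `lim sup` inequalities, here as the
squeeze `(f_k/a₂)^{1/k} ≤ g_k^{1/k} ≤ (f_k/a₁)^{1/k}` with `a^{1/k} → 1`; by symmetry the roles of
`f` and `g` may be exchanged. [cite: LuenbergerYe2008, §6.7 Proposition (and its proof)] -/
theorem averageRatio_of_sandwich {f g : ℕ → ℝ} {a₁ a₂ β : ℝ} (ha₁ : 0 < a₁) (ha₂ : 0 < a₂)
    (hg : ∀ k, 0 ≤ g k) (h1 : ∀ k, a₁ * g k ≤ f k) (h2 : ∀ k, f k ≤ a₂ * g k)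
    (hf : Tendsto (fun k : ℕ => f k ^ (1 / (k : ℝ))) atTop (𝓝 β)) :
    Tendsto (fun k : ℕ => g k ^ (1 / (k : ℝ))) atTop (𝓝 β) := by
  have hf0 : ∀ k, 0 ≤ f k := fun k => le_trans (mul_nonneg ha₁.le (hg k)) (h1 k)
  -- lower bound: (f_k / a₂)^{1/k} = (1/a₂)^{1/k} f_k^{1/k} ≤ g_k^{1/k}
  have lo : ∀ k : ℕ, (1 / a₂) ^ (1 / (k : ℝ)) * f k ^ (1 / (k : ℝ)) ≤ g k ^ (1 / (k : ℝ)) := by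
    intro k
    rw [← Real.mul_rpow (by positivity) (hf0 k)]
    apply Real.rpow_le_rpow (mul_nonneg (by positivity) (hf0 k)) _ (by positivity)
    rw [one_div_mul_eq_div, div_le_iff₀ ha₂]
    linarith [h2 k]
  -- upper bound: g_k^{1/k} ≤ (f_k / a₁)^{1/k} = (1/a₁)^{1/k} f_k^{1/k}
  have hi : ∀ k : ℕ, g k ^ (1 / (k : ℝ)) ≤ (1 / a₁) ^ (1 / (k : ℝ)) * f k ^ (1 / (k : ℝ)) := by
    intro k
    rw [← Real.mul_rpow (by positivity) (hf0 k)]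
    apply Real.rpow_le_rpow (hg k) _ (by positivity)
    rw [one_div_mul_eq_div, le_div_iff₀ ha₁]
    linarith [h1 k]
  -- `c^{1/k} → 1` for `c > 0` (the constants disappear from average rates)
  have hroot : ∀ {c : ℝ}, 0 < c → Tendsto (fun k : ℕ => c ^ (1 / (k : ℝ))) atTop (𝓝 1) := by
    intro c hc
    have h2 := (Real.continuousAt_const_rpow hc.ne').tendsto.comp tendsto_one_div_atTop_nhds_zero_nat
    simpa [Function.comp_def, Real.rpow_zero] using h2
  have tlo : Tendsto (fun k : ℕ => (1 / a₂) ^ (1 / (k : ℝ)) * f k ^ (1 / (k : ℝ))) atTop (𝓝 β) := by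
    have := (hroot (c := 1 / a₂) (by positivity)).mul hf
    rwa [one_mul] at this
  have thi : Tendsto (fun k : ℕ => (1 / a₁) ^ (1 / (k : ℝ)) * f k ^ (1 / (k : ℝ))) atTop (𝓝 β) := by
    have := (hroot (c := 1 / a₁) (by positivity)).mul hf
    rwa [one_mul] at this
  exact tendsto_of_tendsto_of_tendsto_of_le_of_le tlo thi lo hi

/-- The Proposition in the language of `HasAverageRatio`: error sequences `f(x_k)`, `g(x_k)` of a
vector sequence, sandwiched as in the Proposition, have the same average convergence ratio.
[cite: LuenbergerYe2008, §6.7 Proposition; the example after it (g = |x − x*|², f = (x − x*)ᵀQ(x −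
x*), a₁, a₂ the extreme eigenvalues of Q)] -/
theorem hasAverageRatio_of_sandwich {X : Type*} {x : ℕ → X} {f g : X → ℝ} {a₁ a₂ β : ℝ}
    (ha₁ : 0 < a₁) (ha₂ : 0 < a₂) (hg : ∀ y, 0 ≤ g y) (h1 : ∀ y, a₁ * g y ≤ f y)
    (h2 : ∀ y, f y ≤ a₂ * g y) (hf : HasAverageRatio (fun k => f (x k)) 0 β) :
    HasAverageRatio (fun k => g (x k)) 0 β := by
  unfold HasAverageRatio avgRoot at *
  have hf0 : ∀ y, 0 ≤ f y := fun y => le_trans (mul_nonneg ha₁.le (hg y)) (h1 y)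
  simp only [sub_zero] at *
  have hf' : Tendsto (fun k : ℕ => f (x k) ^ (1 / (k : ℝ))) atTop (𝓝 β) := by
    refine hf.congr' (Eventually.of_forall fun k => ?_)
    simp only [abs_of_nonneg (hf0 (x k))]
  have := averageRatio_of_sandwich (f := fun k => f (x k)) (g := fun k => g (x k)) ha₁ ha₂
    (fun k => hg (x k)) (fun k => h1 (x k)) (fun k => h2 (x k)) hf'
  refine this.congr' (Eventually.of_forall fun k => ?_)
  simp only [abs_of_nonneg (hg (x k))]

end Literature.Analysis.Convex.SpeedOfConvergence
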